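import Summits.Ventures.HSemireg.ExtRankOfSchemeIso
import HarnessLib

/-!
# Venture HSemireg — target seat 7's σ-notion `sigmaAdmissible` (WITH `Hom(E,E) = ℂ`) along an isomorphism of the base:
# reduced to the same σ_q-level statement as the gluable notion

research route conditional on HC_CM; not a corollary; Q11.4-sentence-2 already refuted in dim ≥ 3.

HONEST FRAMING. Kernel bookkeeping (seat ring2-b06 gen 118; idle-time item, ring2 LEAD 152 ruling L152.5 (R3)). With ALL `Ext`-ranks
transporting along `e^*` (`extRank_pullback_eq`, `ExtRankOfSchemeIso.lean`), the simplicity conjunct `extRank X₀ E 0 = 1` of target seat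
7's `sigmaAdmissible` (`PerfectComplexSigmaDoor.lean`) transports too, so `sigmaAdmissible` — like `gluableSigmaAdmissible`
(`AmplificationChainSigmaGluableOfSchemeIso.lean`) — is invariant under pull-back along isomorphisms of `ℂ`-schemes AS SOON AS the joint
injectivity `HomComplex.IsISemiregularC` is (hypothesis `hσC`, the banked by-name support target `HomComplex.IsISemiregularC.of_schemeIso`):
`sigmaAdmissible.pullback_of_schemeIso_of_isISemiregularC` (pointwise) and `sigmaAdmissible_pullback_of_schemeIso_of_isISemiregularC`
(displayed shape). Nothing here asserts `hσC`; no notion is re-typed (target seat 7's definition is used verbatim through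
`sigmaAdmissible_iff_gluable_and_extRank_zero`).

NOT here: any object, any door word; no skeleton / route change; no `instance`, no axiom, no Literature fact; HC_CM, HC_AV, HC nowhere.
References: [BuchweitzFlenner2003] Def. 4.1, §5 · [Lieblich2006] Prop. 2.1.9 · [Mukai1981] Cor. 2.5 (`Hom = ℂ` for simple objects).
-/

noncomputable section

open CategoryTheory CategoryTheory.Limits AlgebraicGeometry
open AlgebraicGeometry.Scheme.Modules
open Literature.AlgebraicGeometry Literature.AlgebraicGeometry.Motives Literature.AlgebraicGeometry.Modules
open Literature.AlgebraicGeometry.HodgeTheory Literature.AlgebraicGeometry.KTheory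

namespace Summit.Ventures.HSemireg

variable {Y Y' : SchemeOver ℂ}

/-- **`sigmaAdmissible` transports along an isomorphism `e : Y' ≅ Y` of `ℂ`-schemes as soon as `IsISemiregularC` does** (pointwise form):
the gluable part by `gluableSigmaAdmissible.pullback_of_schemeIso_of_isISemiregularC`, the simplicity conjunct `Hom(E,E) = ℂ` by
`extRank_pullback_eq`. [cite: BuchweitzFlenner2003, §5 (I-semiregular)] [cite: Mukai1981, Cor. 2.5] -/
theorem sigmaAdmissible.pullback_of_schemeIso_of_isISemiregularC (e : Y' ≅ Y) {n : ℕ} {I : Finset ℕ}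
    {E : CochainComplex Y.left.Modules ℤ}
    (hσC : ∀ (a b : ℤ) [E.IsStrictlyGE a] [E.IsStrictlyLE b] (hE : ∀ i, IsFiniteLocallyFree (E.X i)),
      letI := HasDerivedCategory.standard Y.left.Modules
      letI := HasDerivedCategory.standard Y'.left.Modules
      HomComplex.IsISemiregularC Y E a b hE {q | q + 1 ∈ I} →
        HomComplex.IsISemiregularC Y' (((Scheme.Modules.pullback e.hom.left).mapHomologicalComplex _).obj E) a b
          (fun i => (hE i).pullback e.hom.left) {q | q + 1 ∈ I})
    (h : sigmaAdmissible n Y I E) :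
    sigmaAdmissible n Y' I (((Scheme.Modules.pullback e.hom.left).mapHomologicalComplex _).obj E) := by
  rw [sigmaAdmissible_iff_gluable_and_extRank_zero] at h ⊢
  exact ⟨h.1.pullback_of_schemeIso_of_isISemiregularC e hσC, (extRank_pullback_eq e E 0).trans h.2⟩

/-- **The displayed shape for target seat 7's notion**: if `IsISemiregularC` transports along pull-back by every isomorphism of
`ℂ`-schemes (`hσC`, verbatim the banked target's signature), then so does `sigmaAdmissible`, on bounded complexes of vector bundles.
[cite: BuchweitzFlenner2003, Def. 4.1 and §5 (I-semiregular)] [cite: Lieblich2006, Prop. 2.1.9] -/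
theorem sigmaAdmissible_pullback_of_schemeIso_of_isISemiregularC
    (hσC : ∀ ⦃Y Y' : SchemeOver ℂ⦄ (e : Y' ≅ Y) (E : CochainComplex Y.left.Modules ℤ) (a b : ℤ)
      [E.IsStrictlyGE a] [E.IsStrictlyLE b] (hE : ∀ i, IsFiniteLocallyFree (E.X i)) (J : Set ℕ),
      letI := HasDerivedCategory.standard Y.left.Modules
      letI := HasDerivedCategory.standard Y'.left.Modules
      HomComplex.IsISemiregularC Y E a b hE J →
        HomComplex.IsISemiregularC Y' (((Scheme.Modules.pullback e.hom.left).mapHomologicalComplex _).obj E) a b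
          (fun i => (hE i).pullback e.hom.left) J) :
    ∀ (n : ℕ) ⦃Y Y' : SchemeOver ℂ⦄ (e : Y' ≅ Y) (I : Finset ℕ) (E : CochainComplex Y.left.Modules ℤ),
      IsBoundedVBComplex E → sigmaAdmissible n Y I E →
        sigmaAdmissible n Y' I (((Scheme.Modules.pullback e.hom.left).mapHomologicalComplex _).obj E) :=
  fun _ _ _ e I E _ h => h.pullback_of_schemeIso_of_isISemiregularC e fun a b _ _ hE => hσC e E a b hE {q | q + 1 ∈ I}

end Summit.Ventures.HSemireg

end
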